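import Literature.IUT.HodgeArakelov.GaloisPairRigidityGenuineAtModelTate
import Literature.IUT.HodgeArakelov.BadPlaceSettingAtModelTate
import HarnessLib

/-!
# [IUTchII] Rmk 1.11.1 (i) (a)(b) and Rmk 1.11.2 (i) AT THE CARRIER OF RECORD of the Tate model — every `Prop`
# binder a theorem of the tree (proof-only; L-F register rows LF6-34 / LF6-35, F-0417 · F-0418 · F-0419)

S. Mochizuki, *Inter-universal Teichmüller theory II*, kurims manuscript (Dec. 2020), §1 Remark 1.11.1 (i) (a), (b)
pp. 49–50 («the group of automorphisms of the … MLF-Galois TM-pair … `G ↷ O^⊳(G)` maps bijectively [i.e., by forgetting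
`O^⊳(G)`] onto the group of automorphisms of the topological group `G`»; «… `G ↷ O^×(G)` … maps surjectively … with
kernel given by the … automorphisms … determined by the natural action of `Ẑ^×`»), Remark 1.11.2 (i) pp. 50–51 («this
action of `Ẑ^×` fails to be compatible with the ring structure on `O^×(G) ⊗ ℚ`»), and the arithmetic side conditions of
§1 p. 20 («`l` an odd prime», «`p ≠ l`, `p` odd», «`k` contains a primitive `4l`-th root of unity»)
[claim: Mochizuki2012, status: disputed] (IUTchII §1 Rmk 1.11.1 (i), kurims pp.49-50).  The cited inputs are
[AbsTopIII] Prop. 3.2 (iv) / Prop. 3.3 (ii) (Mochizuki, *Topics in absolute anabelian geometry III*).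

Cell `abc-iut`, seat abc-iut-L1-t11 (gen 10), L-F register rows **LF6-34** (F-0417 `Rmk1111_a` + F-0418 `Rmk1111_b`) and
**LF6-35** (F-0419 `Rmk1112_i`) of abc-iut-L6-lead's `plan/L6/LF-IUT.tsv` (L6 ROWS #4).  PROOF-ONLY: no definition, no
instance, no new named fact; every input consumed BY NAME.

STATE OF RECORD.  The three frozen FACT-LIST rows type [IUTchII] Rmk. 1.11.1 (i) (a)/(b) and Rmk. 1.11.2 (i) as SCHEMAS
over abc-iut-L6-t1's `[AbsTopIII]`-output interface `AbsTopMonoids S`; their universal closures are REFUTED in the tree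
(`not_forall_rmk1111_a`, `not_forall_rmk1111_b` — p458440; `not_forall_Rmk1112_i`, `not_Rmk1112_i_punit` — p436363),
so the instance forms are the content.  The tree proves them UNCONDITIONALLY at abc-iut-L6-d2's all-fields-genuine
producer `AbsTopMonoids.genuineOfModelIsm S C ε hΔ hq` for EVERY theta setting `S`, closure datum `C`, `ε`
(`rmk1111_a_genuineOfModelIsm` p429824, `Genuine.rmk1111_b_genuineOfModelIsm` p431864,
`Genuine.rmk1112_i_genuineOfModelIsm` p436363), and abc-iut-L6-d2 (gen 9) discharged the producer's two binders
(H1) `hΔ` / (H2) `hq` at the [IUTchII] §1 settings `ThetaSetting.ofDoubleUnderline C μ hC hS hl hp2 hpl hζ hη` over the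
stage-2 Tate model `ThetaSetting.modelχq p i j` (`GaloisPairRigidityGenuineAtModelTate`, p491728:
`exists_allGenuine_gprChain_ofDoubleUnderlinePadic_modelχq` — (a) as a conjunct —, `rmk1111_b_genuineOfModelIsm_modelχq`,
`rmk1112_i_genuineOfModelIsm_modelχq'`), keeping the model-side binders `C, μ, hC, hS, hl, hp2, hpl, hζ, hη`.

THIS FILE pins the three facts at abc-iut-w5-d233's CARRIER OF RECORD of the Tate model `modelχq p 1 2`
(`BadPlaceSettingAtModelTate`, p453435): the `X̲̲`-choice `C` over the `inr`-section étale-theta datum carrying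
`η̈♯ = etaDdχq` (abc-iut-L2-d1 `doubleUnderlineχqOfEtaRes`), `hC := compat_modelχq`, `hS := ThetaSetting.modelχq_sec2Hyps`,
`hp2`, `hpl`, `hζ` from the ONE arithmetic side condition `4l ∣ p − 1` (`ne_two_of_four_mul_dvd_pred`,
`ne_of_four_mul_dvd_pred`, `exists_isPrimitiveRoot_K_modelχq`), `hη :=` the mod-`N` one-root lift
(`EtaleThetaDataOfSetting.modN_rootLift_mem_thetaCocycles`), and (H1)/(H2) the theorems of p489543 / p486362
(`deltaX_characteristic_ofDoubleUnderline_modelχq_of_ker_ne_bot'` ∘ `ker_tatePairHom_ne_bot`,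
`nonempty_quotDeltaX_iso_ofDoubleUnderline_modelχq`).  What is left in each statement is DATA ONLY: the prime `p`, the
odd prime `l` with `4l ∣ p − 1`, the level `N`, the cyclotome identification `μ` (inhabited: abc-iut-L2-t8
`modelχq_nonempty_cyclotomeMod`) — and, for Rmk. 1.11.2 (i), the isomorph `G`:
* `rmk1111_a_modelTateRecord` — **F-0417** `Rmk1111_a` HOLDS at the carrier of record (conclusion head = the FACT decl);
* `rmk1111_b_modelTateRecord` — **F-0418** `Rmk1111_b` HOLDS there with `zhatPow :=` abc-iut-w6-d010's `Genuine.zhatPowOunits`;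
* `rmk1112_i_modelTateRecord` — **F-0419** `Rmk1112_i` HOLDS there at every `G`, with `L := ℚ̄_p`, `toL :=` the `p`-adic
  logarithm on units, ring multiplication, and `Ẑ^×` acting through the `p`-adic cyclotomic character (abc-iut-w6-d020);
* `gprRows_modelTateRecord` — the three in ONE conjunction (joint satisfiability at one carrier, one producer);
* `gprRows_modelTateRecord_thirteen_three` — the same at `p = 13`, `l = 3` (`4·3 ∣ 12`): NO `Prop` binder at all, only the
  data `N`, `μ`, `G` quantified.

HONEST LABEL: `modelχq p 1 2` is a SEMI-SYNTHETIC model of the typed [EtTh] §1 interface (not the tempered `π₁` of a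
curve): this is OUR kernel check that OUR typed instance forms of the three rows hold TOGETHER at one genuine (non-toy)
carrier with no `Prop` binder left; an instance-form theorem at OUR model is not the print universal closure (which is
refuted AS TYPED); the claim key `Mochizuki2012` is DISPUTED (D-0012) and nothing of it is asserted; no side is taken on
[IUTchIII] Cor. 3.12; typed ≠ proved; nothing here says abc is proved or refuted.
-/

noncomputable section

namespace Literature.IUT.HodgeArakelov

open Literature.AnabelianGeometry.AbsoluteAnabelian
open Literature.AnabelianGeometry.EtaleTheta Literature.AnabelianGeometry.SemiGraphs
open Literature.AnabelianGeometry.EtaleTheta.SettingModel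
open scoped Literature.AnabelianGeometry.EtaleTheta

namespace ModelTateCarriers

variable (p : ℕ) [Fact p.Prime] (l : ℕ+) (hl : Odd (l : ℕ)) (hlp : (l : ℕ).Prime) (hdvd : 4 * (l : ℕ) ∣ p - 1)
  {N : ℕ+} (μ : (ThetaSetting.modelχq p 1 2 even_two).CyclotomeMod l N)

/-- **F-0417 — [IUTchII] Rmk. 1.11.1 (i) (a) at the carrier of record of the Tate model, NO `Prop` binder**: forgetting
`O^⊳(G) = 𝒪^⊳_{ℚ̄_p}`, `Aut(G ↷ O^⊳(G)) → Aut(G)` is a bijection at every isomorph `G` of `G_K`, for the all-fields-genuine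
producer over the `X̲̲` of record of `modelχq p 1 2` (abc-iut-w6-d010's `rmk1111_a_genuineOfModelIsm` with (H1)/(H2) and every
model-side binder supplied by name).  Data left: `p`, the odd prime `l` with `4l ∣ p − 1`, `N`, `μ`.
[claim: Mochizuki2012, status: disputed] (IUTchII §1 Rmk 1.11.1 (i), kurims pp.49-50) -/
theorem rmk1111_a_modelTateRecord :
    let C := (((kummerCoreχq p 1 2 even_two).toKummerDataOfSection SemidirectProduct.inr (continuous_inrχq p 1 2)
        (fun _ => rfl) (map_inr_GK_le_GtpY_modelχq' p 1 2 even_two)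
        (map_inr_GKdd_le_GtpYdd_modelχq' p 1 2 even_two)).etaleThetaDataOfClass
        (etaDdχq p 1 2 even_two)).doubleUnderlineχqOfEtaRes p 1 2 l hl (eta_res_etaDdχq p 1 2 even_two l hl)
    let hη := EtaleThetaDataOfSetting.modN_rootLift_mem_thetaCocycles C (compat_modelχq p 1 2 even_two)
        (ThetaSetting.modelχq_sec2Hyps p 1 2 even_two) μ
    let S := ThetaSetting.ofDoubleUnderline C μ (compat_modelχq p 1 2 even_two)
        (ThetaSetting.modelχq_sec2Hyps p 1 2 even_two) hlp (ne_two_of_four_mul_dvd_pred p l.pos hdvd)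
        (ne_of_four_mul_dvd_pred p l.pos hdvd) (exists_isPrimitiveRoot_K_modelχq p 1 2 even_two l.pos hdvd) hη
    Rmk1111_a
      (AbsTopMonoids.genuineOfModelIsm S
        (ThetaSetting.modelχq p 1 2 even_two).toTemperedCurve.mlfClosurePadic
        (ThetaSetting.modelχq p 1 2 even_two).toTemperedCurve.galoisEpsilonPadic
        (deltaX_characteristic_ofDoubleUnderline_modelχq_of_ker_ne_bot' p 1 2 even_two C μ
          (compat_modelχq p 1 2 even_two) (ThetaSetting.modelχq_sec2Hyps p 1 2 even_two) hlp
          (ne_two_of_four_mul_dvd_pred p l.pos hdvd) (ne_of_four_mul_dvd_pred p l.pos hdvd)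
          (exists_isPrimitiveRoot_K_modelχq p 1 2 even_two l.pos hdvd) hη (ker_tatePairHom_ne_bot p 1 2))
        (AbsTopMonoids.nonempty_quotDeltaX_iso_ofDoubleUnderline_modelχq p 1 2 even_two C μ
          (compat_modelχq p 1 2 even_two) (ThetaSetting.modelχq_sec2Hyps p 1 2 even_two) hlp
          (ne_two_of_four_mul_dvd_pred p l.pos hdvd) (ne_of_four_mul_dvd_pred p l.pos hdvd)
          (exists_isPrimitiveRoot_K_modelχq p 1 2 even_two l.pos hdvd) hη)) := by
  intro C hη S
  exact AbsTopMonoids.rmk1111_a_genuineOfModelIsm S _ _ _ _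

/-- **F-0418 — [IUTchII] Rmk. 1.11.1 (i) (b) at the carrier of record of the Tate model, NO `Prop` binder**: for
`G ↷ O^×(G) = (G ↷ (𝒪^⊳_{ℚ̄_p})ˣ)` the forgetful map to `Aut(G)` is surjective with kernel the natural `Ẑ^×`-action
`zhatPow := Genuine.zhatPowOunits` (abc-iut-w6-d010's `Genuine.rmk1111_b_genuineOfModelIsm`, at the explicit producer over the
`X̲̲` of record of `modelχq p 1 2`; abc-iut-L6-d2's `rmk1111_b_genuineOfModelIsm_modelχq` with `hC, hS, hp2, hpl, hζ, hη` supplied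
by name).  Data left: `p`, the odd prime `l` with `4l ∣ p − 1`, `N`, `μ`.
[claim: Mochizuki2012, status: disputed] (IUTchII §1 Rmk 1.11.1 (i), kurims p.50) -/
theorem rmk1111_b_modelTateRecord :
    let C := (((kummerCoreχq p 1 2 even_two).toKummerDataOfSection SemidirectProduct.inr (continuous_inrχq p 1 2)
        (fun _ => rfl) (map_inr_GK_le_GtpY_modelχq' p 1 2 even_two)
        (map_inr_GKdd_le_GtpYdd_modelχq' p 1 2 even_two)).etaleThetaDataOfClass
        (etaDdχq p 1 2 even_two)).doubleUnderlineχqOfEtaRes p 1 2 l hl (eta_res_etaDdχq p 1 2 even_two l hl)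
    let hη := EtaleThetaDataOfSetting.modN_rootLift_mem_thetaCocycles C (compat_modelχq p 1 2 even_two)
        (ThetaSetting.modelχq_sec2Hyps p 1 2 even_two) μ
    let S := ThetaSetting.ofDoubleUnderline C μ (compat_modelχq p 1 2 even_two)
        (ThetaSetting.modelχq_sec2Hyps p 1 2 even_two) hlp (ne_two_of_four_mul_dvd_pred p l.pos hdvd)
        (ne_of_four_mul_dvd_pred p l.pos hdvd) (exists_isPrimitiveRoot_K_modelχq p 1 2 even_two l.pos hdvd) hη
    Rmk1111_b
      (AbsTopMonoids.genuineOfModelIsm S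
        (ThetaSetting.modelχq p 1 2 even_two).toTemperedCurve.mlfClosurePadic
        (ThetaSetting.modelχq p 1 2 even_two).toTemperedCurve.galoisEpsilonPadic
        (deltaX_characteristic_ofDoubleUnderline_modelχq_of_ker_ne_bot' p 1 2 even_two C μ
          (compat_modelχq p 1 2 even_two) (ThetaSetting.modelχq_sec2Hyps p 1 2 even_two) hlp
          (ne_two_of_four_mul_dvd_pred p l.pos hdvd) (ne_of_four_mul_dvd_pred p l.pos hdvd)
          (exists_isPrimitiveRoot_K_modelχq p 1 2 even_two l.pos hdvd) hη (ker_tatePairHom_ne_bot p 1 2))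
        (AbsTopMonoids.nonempty_quotDeltaX_iso_ofDoubleUnderline_modelχq p 1 2 even_two C μ
          (compat_modelχq p 1 2 even_two) (ThetaSetting.modelχq_sec2Hyps p 1 2 even_two) hlp
          (ne_two_of_four_mul_dvd_pred p l.pos hdvd) (ne_of_four_mul_dvd_pred p l.pos hdvd)
          (exists_isPrimitiveRoot_K_modelχq p 1 2 even_two l.pos hdvd) hη))
      (fun _ => AbsTopMonoids.Genuine.zhatPowOunits
        (ThetaSetting.modelχq p 1 2 even_two).toTemperedCurve.mlfClosurePadic) := by
  intro C hη S
  exact AbsTopMonoids.rmk1111_b_genuineOfModelIsm_modelχq p 1 2 even_two C μ _ _ hlp _ _ _ hη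

/-- **F-0419 — [IUTchII] Rmk. 1.11.2 (i) at the carrier of record of the Tate model, NO `Prop` binder**: at every isomorph `G`
of `G_K`, the `Ẑ^×`-action on `G ↷ O^×(G)` extends (through the `p`-adic cyclotomic character) to `L := O^×(G) ⊗ ℚ = ℚ̄_p`
compatibly with the `p`-adic logarithm `toL`, and some `u ∈ Ẑ^×` (namely `−1`) does NOT act multiplicatively for the ring
structure (abc-iut-w6-d020's `Genuine.rmk1112_i_genuineOfModelIsm`; abc-iut-L6-d2's `rmk1112_i_genuineOfModelIsm_modelχq'`, whose
residue-characteristic `Fact` is the theorem `MLFClosure.fact_residueChar_prime`, with `hC, hS, hp2, hpl, hζ, hη` supplied by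
name).  Data left: `p`, the odd prime `l` with `4l ∣ p − 1`, `N`, `μ`, `G`.
[claim: Mochizuki2012, status: disputed] (IUTchII §1 Rmk 1.11.2 (i), kurims pp.50-51) -/
theorem rmk1112_i_modelTateRecord :
    let C := (((kummerCoreχq p 1 2 even_two).toKummerDataOfSection SemidirectProduct.inr (continuous_inrχq p 1 2)
        (fun _ => rfl) (map_inr_GK_le_GtpY_modelχq' p 1 2 even_two)
        (map_inr_GKdd_le_GtpYdd_modelχq' p 1 2 even_two)).etaleThetaDataOfClass
        (etaDdχq p 1 2 even_two)).doubleUnderlineχqOfEtaRes p 1 2 l hl (eta_res_etaDdχq p 1 2 even_two l hl)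
    let hη := EtaleThetaDataOfSetting.modN_rootLift_mem_thetaCocycles C (compat_modelχq p 1 2 even_two)
        (ThetaSetting.modelχq_sec2Hyps p 1 2 even_two) μ
    let S := ThetaSetting.ofDoubleUnderline C μ (compat_modelχq p 1 2 even_two)
        (ThetaSetting.modelχq_sec2Hyps p 1 2 even_two) hlp (ne_two_of_four_mul_dvd_pred p l.pos hdvd)
        (ne_of_four_mul_dvd_pred p l.pos hdvd) (exists_isPrimitiveRoot_K_modelχq p 1 2 even_two l.pos hdvd) hη
    ∀ G : IsoClass S.Gk,
      haveI := (ThetaSetting.modelχq p 1 2 even_two).toTemperedCurve.mlfClosurePadic.fact_residueChar_prime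
      Rmk1112_i
        (AbsTopMonoids.genuineOfModelIsm S
          (ThetaSetting.modelχq p 1 2 even_two).toTemperedCurve.mlfClosurePadic
          (ThetaSetting.modelχq p 1 2 even_two).toTemperedCurve.galoisEpsilonPadic
          (deltaX_characteristic_ofDoubleUnderline_modelχq_of_ker_ne_bot' p 1 2 even_two C μ
            (compat_modelχq p 1 2 even_two) (ThetaSetting.modelχq_sec2Hyps p 1 2 even_two) hlp
            (ne_two_of_four_mul_dvd_pred p l.pos hdvd) (ne_of_four_mul_dvd_pred p l.pos hdvd)
            (exists_isPrimitiveRoot_K_modelχq p 1 2 even_two l.pos hdvd) hη (ker_tatePairHom_ne_bot p 1 2))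
          (AbsTopMonoids.nonempty_quotDeltaX_iso_ofDoubleUnderline_modelχq p 1 2 even_two C μ
            (compat_modelχq p 1 2 even_two) (ThetaSetting.modelχq_sec2Hyps p 1 2 even_two) hlp
            (ne_two_of_four_mul_dvd_pred p l.pos hdvd) (ne_of_four_mul_dvd_pred p l.pos hdvd)
            (exists_isPrimitiveRoot_K_modelχq p 1 2 even_two l.pos hdvd) hη))
        G
        (AbsTopMonoids.Genuine.zhatPowOunits (ThetaSetting.modelχq p 1 2 even_two).toTemperedCurve.mlfClosurePadic)
        (ThetaSetting.modelχq p 1 2 even_two).toTemperedCurve.mlfClosurePadic.K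
        (MonoidHom.toAdditiveLeft
          ((ThetaSetting.modelχq p 1 2 even_two).toTemperedCurve.mlfClosurePadic.galoisPadicLog.logHom.comp
            (AbsTopMonoids.Genuine.unitsBridge
              (ThetaSetting.modelχq p 1 2 even_two).toTemperedCurve.mlfClosurePadic).toMonoidHom))
        (· * ·)
        (AddAut.mulLeft.comp
          ((ThetaSetting.modelχq p 1 2 even_two).toTemperedCurve.mlfClosurePadic.padicScalarUnits.comp
            (ZHatLevel.padicCharUnits
              (ThetaSetting.modelχq p 1 2 even_two).toTemperedCurve.mlfClosurePadic.residueChar))) := by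
  intro C hη S G
  exact AbsTopMonoids.rmk1112_i_genuineOfModelIsm_modelχq' p 1 2 even_two C μ _ _ hlp _ _ _ hη G

/-- **The three rows TOGETHER at one carrier and one producer** (joint satisfiability of OUR typed instance forms of
F-0417 · F-0418 · F-0419 at the `X̲̲` of record of the Tate model; data left: `p`, `l`, `N`, `μ`).
[claim: Mochizuki2012, status: disputed] (IUTchII §1 Rmk 1.11.1 (i), kurims pp.49-51) -/
theorem gprRows_modelTateRecord :
    let C := (((kummerCoreχq p 1 2 even_two).toKummerDataOfSection SemidirectProduct.inr (continuous_inrχq p 1 2)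
        (fun _ => rfl) (map_inr_GK_le_GtpY_modelχq' p 1 2 even_two)
        (map_inr_GKdd_le_GtpYdd_modelχq' p 1 2 even_two)).etaleThetaDataOfClass
        (etaDdχq p 1 2 even_two)).doubleUnderlineχqOfEtaRes p 1 2 l hl (eta_res_etaDdχq p 1 2 even_two l hl)
    let hη := EtaleThetaDataOfSetting.modN_rootLift_mem_thetaCocycles C (compat_modelχq p 1 2 even_two)
        (ThetaSetting.modelχq_sec2Hyps p 1 2 even_two) μ
    let S := ThetaSetting.ofDoubleUnderline C μ (compat_modelχq p 1 2 even_two)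
        (ThetaSetting.modelχq_sec2Hyps p 1 2 even_two) hlp (ne_two_of_four_mul_dvd_pred p l.pos hdvd)
        (ne_of_four_mul_dvd_pred p l.pos hdvd) (exists_isPrimitiveRoot_K_modelχq p 1 2 even_two l.pos hdvd) hη
    let A := AbsTopMonoids.genuineOfModelIsm S
        (ThetaSetting.modelχq p 1 2 even_two).toTemperedCurve.mlfClosurePadic
        (ThetaSetting.modelχq p 1 2 even_two).toTemperedCurve.galoisEpsilonPadic
        (deltaX_characteristic_ofDoubleUnderline_modelχq_of_ker_ne_bot' p 1 2 even_two C μ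
          (compat_modelχq p 1 2 even_two) (ThetaSetting.modelχq_sec2Hyps p 1 2 even_two) hlp
          (ne_two_of_four_mul_dvd_pred p l.pos hdvd) (ne_of_four_mul_dvd_pred p l.pos hdvd)
          (exists_isPrimitiveRoot_K_modelχq p 1 2 even_two l.pos hdvd) hη (ker_tatePairHom_ne_bot p 1 2))
        (AbsTopMonoids.nonempty_quotDeltaX_iso_ofDoubleUnderline_modelχq p 1 2 even_two C μ
          (compat_modelχq p 1 2 even_two) (ThetaSetting.modelχq_sec2Hyps p 1 2 even_two) hlp
          (ne_two_of_four_mul_dvd_pred p l.pos hdvd) (ne_of_four_mul_dvd_pred p l.pos hdvd)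
          (exists_isPrimitiveRoot_K_modelχq p 1 2 even_two l.pos hdvd) hη)
    Rmk1111_a A ∧
      Rmk1111_b A (fun _ => AbsTopMonoids.Genuine.zhatPowOunits
        (ThetaSetting.modelχq p 1 2 even_two).toTemperedCurve.mlfClosurePadic) ∧
      ∀ G : IsoClass S.Gk,
        haveI := (ThetaSetting.modelχq p 1 2 even_two).toTemperedCurve.mlfClosurePadic.fact_residueChar_prime
        Rmk1112_i A G
          (AbsTopMonoids.Genuine.zhatPowOunits (ThetaSetting.modelχq p 1 2 even_two).toTemperedCurve.mlfClosurePadic)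
          (ThetaSetting.modelχq p 1 2 even_two).toTemperedCurve.mlfClosurePadic.K
          (MonoidHom.toAdditiveLeft
            ((ThetaSetting.modelχq p 1 2 even_two).toTemperedCurve.mlfClosurePadic.galoisPadicLog.logHom.comp
              (AbsTopMonoids.Genuine.unitsBridge
                (ThetaSetting.modelχq p 1 2 even_two).toTemperedCurve.mlfClosurePadic).toMonoidHom))
          (· * ·)
          (AddAut.mulLeft.comp
            ((ThetaSetting.modelχq p 1 2 even_two).toTemperedCurve.mlfClosurePadic.padicScalarUnits.comp
              (ZHatLevel.padicCharUnits
                (ThetaSetting.modelχq p 1 2 even_two).toTemperedCurve.mlfClosurePadic.residueChar))) := by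
  intro C hη S A
  exact ⟨rmk1111_a_modelTateRecord p l hl hlp hdvd μ, rmk1111_b_modelTateRecord p l hl hlp hdvd μ,
    rmk1112_i_modelTateRecord p l hl hlp hdvd μ⟩

/-- **The three rows at ONE fully explicit carrier, NO `Prop` binder at all** — the numeric side conditions of [IUTchII] §1
p. 20 instantiated at `p = 13`, `l = 3` (`4·3 ∣ 13 − 1`): OUR typed instance forms of F-0417 · F-0418 · F-0419 hold together at
the `X̲̲` of record of `modelχq 13 1 2`; the only things quantified are DATA (the level `N`, the cyclotome identification `μ`,
the isomorph `G`).  [claim: Mochizuki2012, status: disputed] (IUTchII §1 Rmk 1.11.1 (i), kurims pp.49-51) -/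
theorem gprRows_modelTateRecord_thirteen_three {N : ℕ+} :
    haveI : Fact (Nat.Prime 13) := ⟨by norm_num⟩
    ∀ μ : (ThetaSetting.modelχq 13 1 2 even_two).CyclotomeMod ((3 : ℕ+) : ℕ) N,
    let hl : Odd ((3 : ℕ+) : ℕ) := by decide
    let hlp : ((3 : ℕ+) : ℕ).Prime := by norm_num
    let hdvd : 4 * ((3 : ℕ+) : ℕ) ∣ 13 - 1 := by decide
      let C := (((kummerCoreχq 13 1 2 even_two).toKummerDataOfSection SemidirectProduct.inr (continuous_inrχq 13 1 2)
          (fun _ => rfl) (map_inr_GK_le_GtpY_modelχq' 13 1 2 even_two)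
          (map_inr_GKdd_le_GtpYdd_modelχq' 13 1 2 even_two)).etaleThetaDataOfClass
          (etaDdχq 13 1 2 even_two)).doubleUnderlineχqOfEtaRes 13 1 2 3 hl (eta_res_etaDdχq 13 1 2 even_two 3 hl)
      let hη := EtaleThetaDataOfSetting.modN_rootLift_mem_thetaCocycles C (compat_modelχq 13 1 2 even_two)
          (ThetaSetting.modelχq_sec2Hyps 13 1 2 even_two) μ
      let S := ThetaSetting.ofDoubleUnderline C μ (compat_modelχq 13 1 2 even_two)
          (ThetaSetting.modelχq_sec2Hyps 13 1 2 even_two) hlp (ne_two_of_four_mul_dvd_pred 13 (3 : ℕ+).pos hdvd)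
          (ne_of_four_mul_dvd_pred 13 (3 : ℕ+).pos hdvd) (exists_isPrimitiveRoot_K_modelχq 13 1 2 even_two (3 : ℕ+).pos hdvd) hη
      let A := AbsTopMonoids.genuineOfModelIsm S
          (ThetaSetting.modelχq 13 1 2 even_two).toTemperedCurve.mlfClosurePadic
          (ThetaSetting.modelχq 13 1 2 even_two).toTemperedCurve.galoisEpsilonPadic
          (deltaX_characteristic_ofDoubleUnderline_modelχq_of_ker_ne_bot' 13 1 2 even_two C μ
            (compat_modelχq 13 1 2 even_two) (ThetaSetting.modelχq_sec2Hyps 13 1 2 even_two) hlp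
            (ne_two_of_four_mul_dvd_pred 13 (3 : ℕ+).pos hdvd) (ne_of_four_mul_dvd_pred 13 (3 : ℕ+).pos hdvd)
            (exists_isPrimitiveRoot_K_modelχq 13 1 2 even_two (3 : ℕ+).pos hdvd) hη (ker_tatePairHom_ne_bot 13 1 2))
          (AbsTopMonoids.nonempty_quotDeltaX_iso_ofDoubleUnderline_modelχq 13 1 2 even_two C μ
            (compat_modelχq 13 1 2 even_two) (ThetaSetting.modelχq_sec2Hyps 13 1 2 even_two) hlp
            (ne_two_of_four_mul_dvd_pred 13 (3 : ℕ+).pos hdvd) (ne_of_four_mul_dvd_pred 13 (3 : ℕ+).pos hdvd)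
            (exists_isPrimitiveRoot_K_modelχq 13 1 2 even_two (3 : ℕ+).pos hdvd) hη)
      Rmk1111_a A ∧
        Rmk1111_b A (fun _ => AbsTopMonoids.Genuine.zhatPowOunits
          (ThetaSetting.modelχq 13 1 2 even_two).toTemperedCurve.mlfClosurePadic) ∧
        ∀ G : IsoClass S.Gk,
          haveI := (ThetaSetting.modelχq 13 1 2 even_two).toTemperedCurve.mlfClosurePadic.fact_residueChar_prime
          Rmk1112_i A G
            (AbsTopMonoids.Genuine.zhatPowOunits (ThetaSetting.modelχq 13 1 2 even_two).toTemperedCurve.mlfClosurePadic)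
            (ThetaSetting.modelχq 13 1 2 even_two).toTemperedCurve.mlfClosurePadic.K
            (MonoidHom.toAdditiveLeft
              ((ThetaSetting.modelχq 13 1 2 even_two).toTemperedCurve.mlfClosurePadic.galoisPadicLog.logHom.comp
                (AbsTopMonoids.Genuine.unitsBridge
                  (ThetaSetting.modelχq 13 1 2 even_two).toTemperedCurve.mlfClosurePadic).toMonoidHom))
            (· * ·)
            (AddAut.mulLeft.comp
              ((ThetaSetting.modelχq 13 1 2 even_two).toTemperedCurve.mlfClosurePadic.padicScalarUnits.comp
                (ZHatLevel.padicCharUnits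
                  (ThetaSetting.modelχq 13 1 2 even_two).toTemperedCurve.mlfClosurePadic.residueChar))) := by
  haveI : Fact (Nat.Prime 13) := ⟨by norm_num⟩
  intro μ hl hlp hdvd C hη S A
  exact gprRows_modelTateRecord 13 3 hl hlp hdvd μ

end ModelTateCarriers

end Literature.IUT.HodgeArakelov

end
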